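import Summits.HodgeConjecture.HodgeConjecture.Theses.MotivatedLefschetzSplit
import Literature.AlgebraicGeometry.HodgeTheory.MiddleDimensionReductionHolds

/-!
# Route MotivatedLefschetzSplit — `MiddleDimensionAndModels` (support item stmt-HodgeConjecture-17935)

`middleDimensionReduction ∧ ∀ n X, nonempty_hodgeModel n X`: both conjuncts are named facts of the
tree DISCHARGED in the tree — `middleDimensionReduction_holds` (the Hodge conjecture reduces to the
middle degree of even-dimensional varieties: Lefschetz pencils / hard Lefschetz) and
`nonempty_hodgeModel_holds` (GAGA + the Hodge decomposition).  No named-fact hypothesis, no sorry.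
-/

-- `Summit.HodgeConjecture.HodgeConjecture.Theorems` is the mandated namespace (single-problem
-- summit: Problem = Summit), which `linter.dupNamespace` flags on every declaration; the lakefile
-- turns the linter off tree-wide (weak option), restated here so stand-alone elaboration is
-- warning-free too.
set_option linter.dupNamespace false

namespace Summit.HodgeConjecture.HodgeConjecture.Theorems

/-- **Item stmt-HodgeConjecture-17935 (`MiddleDimensionAndModels`), route `MotivatedLefschetzSplit`**:
`⟨middleDimensionReduction_holds, nonempty_hodgeModel_holds⟩`. [cite: Thomas2005Nodes, §2 Prop. 2]
[cite: SerreGAGA1956, n° 12 Thm. 1] -/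
theorem motivatedLefschetzSplit_middleDimensionAndModels_proof :
    Summit.HodgeConjecture.HodgeConjecture.Theses.MotivatedLefschetzSplit.MiddleDimensionAndModels :=
  ⟨Literature.AlgebraicGeometry.HodgeTheory.middleDimensionReduction_holds,
    fun _ _ ↦ Literature.AlgebraicGeometry.HodgeTheory.nonempty_hodgeModel_holds⟩

end Summit.HodgeConjecture.HodgeConjecture.Theorems
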